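import Literature.AlgebraicGeometry.HodgeTheory.FermatJuxtapositionGysin
import HarnessLib

/-!
# Aoki's Thm. 1-4 (i) (`Aoki1987_claim_juxtaposition`): the geometric inputs as named facts, and the assembly

Family `hodge`, layer `Literature/AlgebraicGeometry/HodgeTheory`. Decomposition (librarian
`fact-decompose`, 2026-08-16) of the XL named fact `Aoki1987_claim_juxtaposition`
(`FermatInductiveClaims.lean`: Aoki, J. Math. Soc. Japan 39 (1987), Thm. 1-4 (i) = Shioda, Math.
Ann. 245 (1979), Thm. I / da Silva, arXiv:2101.04739, Thm. 2.2 (S) and Cor. 2.3 (a): claim(α) and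
claim(β) imply claim(α∗β), juxtaposition up to permutation of the coordinates) into the FIVE inputs
of the tree's proved assembly `Aoki1987_claim_juxtaposition_of_spans` (`FermatJuxtapositionGysin.lean`,
on the real carriers `fermatEigenspace`, `algebraicClasses`, `complexGysin`, `fermatProjector`;
with `FermatClaimPermutationInvariance.lean` for the permutations and
`FermatInductiveClaimsProofs.lean` for "represents ⟹ claim"):

* `Ran1980_fermatEigenspace_rank_le_one` — (I) `dim V(γ) ≤ 1` for admissible characters `γ` of
  `X²ᵠₘ`, `q > 0` (Aoki p. 385: "It is well known (see [3], [4]) that `dim V(α) = 1` for `α ∈ 𝔄ⁿₘ`";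
  Ran, Compositio Math. 42 (1980), Prop. 1.7 (i); Shioda 1979, §1). This is the hypothesis `hE1`
  shared by ALL assemblies of the layer (`Aoki1987_claim_pStandard_of_represents`,
  `Shioda_claim_paired_of_linearSubspace_represents`, `FermatHodgeConjectureAssembly`).
* `Shioda1979_typeIISpan_represents` — (II) for Hodge characters `α`, `β` of `X²ʳₘ`, `X²ˢₘ`,
  `r, s ≥ 1`, a type-II span `X²ʳₘ ⊗ X²ˢₘ ←π— E —φ→ X^{2(r+s+1)}ₘ` of smooth projective varieties
  (`π` flat, `dim E + 1 = 2(r+s+1)`) one of whose values `Φ(v, w) = φ_*π^*(pr₁^*v ∪ pr₂^*w)`,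
  `v ∈ V(α)`, `w ∈ V(β)`, has non-zero `(α∗β)`-component — Shioda's `ℙ¹`-bundle of the lines joining
  the complementary sub-Fermat varieties `{y = 0}`, `{x = 0}` and his Thm. I ("`f(Z₁ ⊗ Z₂) = m Z₁ ∧ Z₂`",
  `f : V(β′) ⊗ V(γ′) ≅ V(β′∗γ′)`, da Silva Thm. 2.2 (S) (a)–(c)).
* `Shioda1979_coneSpan_represents_left`, `Shioda1979_coneSpan_represents_right` — (III) the same
  with `X⁰ₘ` (`m` points; Aoki's "non-negative even integers" allow `r = 0` or `s = 0`) on one side: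
  cone spans `X²ˢₘ ←π— E —φ→ X^{2(s+1)}ₘ` representing `α∗β`.
* `Shioda1979_lines_represent` — (IV) `r = s = 0`: a curve `φ : E → X²ₘ` whose class `φ_* 1`
  represents `α∗β` (the lines `L` of Thm. 1-1 on the Fermat surface).

`Aoki1987_claim_juxtaposition_holds_of : (I) → (II) → (III-left) → (III-right) → (IV) →
Aoki1987_claim_juxtaposition` is `Aoki1987_claim_juxtaposition_of_spans`. No other definition.
None of (I)–(IV) restates the parent: (I) is a statement on eigenspace dimensions, (II)–(IV) are
existence statements for explicit correspondences and their Gysin images (objects absent from the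
parent), from which the parent follows by flat pull-back / proper push-forward of algebraic classes
and "represents ⟹ claim".

## References

* [Aoki1987] N. Aoki, J. Math. Soc. Japan 39 (1987) 385–396: p. 385 (`dim V(α) = 1`), p. 386
  (represents ⟹ claim), Thm. 1-1, Thm. 1-4 (i) (p. 388).
* [Shioda1979HodgeFermat] T. Shioda, Math. Ann. 245 (1979) 175–184, §1 and Thm. I.
* [Ran1980] Z. Ran, Compositio Math. 42 (1980) 121–142, Prop. 1.7 (i), Thm. 4.9.
* [daSilva2021HodgeFermat] G. da Silva Jr., arXiv:2101.04739, Thm. 2.2 (S) (a)–(c), Cor. 2.3 (a).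
-/

noncomputable section

open CategoryTheory AlgebraicGeometry MonoidalCategory CartesianMonoidalCategory

namespace Literature.AlgebraicGeometry.HodgeTheory

open Literature.AlgebraicTopology.SingularHomology Literature.AlgebraicGeometry.Motives

/-- NAMED FACT — **the character eigenspaces of the Fermat variety are at most lines** (Aoki 1987,
p. 385: "It is well known (see [3], [4]) that `dim V(α) = 1` for `α ∈ 𝔄ⁿₘ`"; Ran 1980, Prop. 1.7 (i);
Shioda 1979, §1): for `m ≥ 1`, `q > 0` and an admissible character `γ` of `X²ᵠₘ` (all `γᵢ ≠ 0`,
`∑ γᵢ = 0`), the eigenspace `V(γ) ⊆ H²ᵠ(X²ᵠₘ(ℂ); ℂ)` (`fermatEigenspace m γ (2q)`) is contained in a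
line `ℂ ∙ u`. (Upper bound only; the printed statement is `dim = 1`.) The hypothesis `hE1` of the
layer's assemblies. [cite: Ran1980, Prop. 1.7 (i)] [cite: Aoki1987, Introduction p. 385] [cite: Shioda1979HodgeFermat, §1] -/
def Ran1980_fermatEigenspace_rank_le_one : Prop :=
  ∀ (m q : ℕ) [NeZero m] (γ : Fin (2 * q + 2) → ZMod m), 0 < q →
    FermatCharacter.IsAdmissible γ → ∃ u, fermatEigenspace m γ (2 * q) ≤ ℂ ∙ u

/-- NAMED FACT — **Shioda's type-II correspondence represents the juxtaposition** (Shioda 1979,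
Thm. I; da Silva 2021, Thm. 2.2 (S) (a)–(c); Aoki 1987, p. 386 and Thm. 1-4 (i)): for `m ≥ 1`,
`r, s ≥ 1` and Hodge characters `α` of `X²ʳₘ`, `β` of `X²ˢₘ`, there is a span of smooth projective
complex varieties `X²ʳₘ ⊗ X²ˢₘ ←π— E —φ→ X^{2(r+s+1)}ₘ` with `π` flat and `dim E + 1 = 2(r+s+1)`
(in print: `E` the `ℙ¹`-bundle of the lines joining the complementary sub-Fermat varieties
`X1 = {y = 0} ≅ X²ʳₘ`, `X2 = {x = 0} ≅ X²ˢₘ` of `X^{2(r+s+1)}ₘ`, `φ` the map onto the ruled join),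
and classes `v ∈ V(α)`, `w ∈ V(β)` such that the type-II value
`Φ(v, w) = φ_*(π^*(pr₁^* v ∪ pr₂^* w))` (`FermatCharacter.typeIISpanMap`) has non-zero
`(α∗β)`-component, `π_{α∗β} Φ(v, w) ≠ 0` (`fermatProjector`, `FermatCharacter.append`) — the content
of "`f(Z₁ ⊗ Z₂) = m Z₁ ∧ Z₂`" with `f : V(β′) ⊗ V(γ′) ≅ V(β′∗γ′)` an equivariant isomorphism.
[cite: Shioda1979HodgeFermat, Thm. I] [cite: daSilva2021HodgeFermat, Thm. 2.2 (S) (a)–(c)] [cite: Aoki1987, Thm. 1-4 (i) p. 388 and p. 386] -/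
def Shioda1979_typeIISpan_represents : Prop :=
  ∀ (m r s : ℕ) [NeZero m] (α : Fin (2 * r + 2) → ZMod m) (β : Fin (2 * s + 2) → ZMod m),
    1 ≤ r → 1 ≤ s → FermatCharacter.IsHodge α → FermatCharacter.IsHodge β →
    ∃ (μ : OrientationFamily) (e : ℕ) (E : Motives.SchemeOver ℂ) (hE : IsSmoothProjective e E)
      (hX : IsSmoothProjective (2 * (r + s + 1)) (fermatHypersurface (2 * (r + s + 1)) m))
      (π : E ⟶ fermatHypersurface (2 * r) m ⊗ fermatHypersurface (2 * s) m) (_ : Flat π.left)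
      (φ : E ⟶ fermatHypersurface (2 * (r + s + 1)) m) (he : e + 1 = 2 * (r + s + 1)),
      ∃ v ∈ fermatEigenspace m α (2 * r), ∃ w ∈ fermatEigenspace m β (2 * s),
        fermatProjector m (FermatCharacter.append α β) (2 * (r + s + 1))
          (FermatCharacter.typeIISpanMap μ hE hX π φ he v w) ≠ 0

/-- NAMED FACT — **cone spans represent `α∗β` when `r = 0`** (Aoki 1987, Thm. 1-4 (i) with `r = 0`,
p. 388 "non-negative even integers", and p. 386; da Silva 2021, Thm. 2.2 (b)): for `m ≥ 1`, `s ≥ 1`,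
Hodge characters `α` of `X⁰ₘ` (`m` points of `ℙ¹`) and `β` of `X²ˢₘ`, there is a span
`X²ˢₘ ←π— E —φ→ X^{2(s+1)}ₘ` of smooth projective varieties (`π` flat, `dim E = 2s + 1`; in print
the completed cones `ℙ(O ⊕ O(−1)) → X²ˢₘ` joining the points of `X⁰ₘ` to `X2 = {x = 0} ≅ X²ˢₘ`)
and `w ∈ V(β)` with `π_{α∗β}(φ_*(π^* w)) ≠ 0`.
[cite: Aoki1987, Thm. 1-4 (i) p. 388 and p. 386] [cite: daSilva2021HodgeFermat, Thm. 2.2 (b)] -/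
def Shioda1979_coneSpan_represents_left : Prop :=
  ∀ (m s : ℕ) [NeZero m] (α : Fin (2 * 0 + 2) → ZMod m) (β : Fin (2 * s + 2) → ZMod m),
    1 ≤ s → FermatCharacter.IsHodge α → FermatCharacter.IsHodge β →
    ∃ (μ : OrientationFamily) (e : ℕ) (E : Motives.SchemeOver ℂ) (hE : IsSmoothProjective e E)
      (hX : IsSmoothProjective (2 * (0 + s + 1)) (fermatHypersurface (2 * (0 + s + 1)) m))
      (π : E ⟶ fermatHypersurface (2 * s) m) (_ : Flat π.left)
      (φ : E ⟶ fermatHypersurface (2 * (0 + s + 1)) m) (he : e = 2 * s + 1),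
      ∃ w ∈ fermatEigenspace m β (2 * s),
        fermatProjector m (FermatCharacter.append α β) (2 * (0 + s + 1))
          (complexGysin μ hE hX φ
            (show 2 * s + 2 * (2 * (0 + s + 1)) = 2 * (0 + s + 1) + 2 * e by omega)
            (complexBetti.map π (2 * s) w)) ≠ 0

/-- NAMED FACT — **cone spans represent `α∗β` when `s = 0`** (the mirror image of
`Shioda1979_coneSpan_represents_left`: cones over `X1 = {y = 0} ≅ X²ʳₘ` with vertices the `m` points
of `X⁰ₘ`; Aoki 1987, Thm. 1-4 (i) p. 388 and p. 386; da Silva 2021, Thm. 2.2 (b)).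
[cite: Aoki1987, Thm. 1-4 (i) p. 388 and p. 386] [cite: daSilva2021HodgeFermat, Thm. 2.2 (b)] -/
def Shioda1979_coneSpan_represents_right : Prop :=
  ∀ (m r : ℕ) [NeZero m] (α : Fin (2 * r + 2) → ZMod m) (β : Fin (2 * 0 + 2) → ZMod m),
    1 ≤ r → FermatCharacter.IsHodge α → FermatCharacter.IsHodge β →
    ∃ (μ : OrientationFamily) (e : ℕ) (E : Motives.SchemeOver ℂ) (hE : IsSmoothProjective e E)
      (hX : IsSmoothProjective (2 * (r + 0 + 1)) (fermatHypersurface (2 * (r + 0 + 1)) m))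
      (π : E ⟶ fermatHypersurface (2 * r) m) (_ : Flat π.left)
      (φ : E ⟶ fermatHypersurface (2 * (r + 0 + 1)) m) (he : e = 2 * r + 1),
      ∃ v ∈ fermatEigenspace m α (2 * r),
        fermatProjector m (FermatCharacter.append α β) (2 * (r + 0 + 1))
          (complexGysin μ hE hX φ
            (show 2 * r + 2 * (2 * (r + 0 + 1)) = 2 * (r + 0 + 1) + 2 * e by omega)
            (complexBetti.map π (2 * r) v)) ≠ 0

/-- NAMED FACT — **lines on the Fermat surface represent `α∗β` for `r = s = 0`** (Aoki 1987, Thm. 1-1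
p. 386 "The linear space `L` represents `δ`" and Thm. 1-4 (i); Shioda 1979, Thm. I): for `m ≥ 1` and
Hodge characters `α = (a, −a)`, `β = (b, −b)` of `X⁰ₘ`, there is a curve `φ : E → X²ₘ` (`E` smooth
projective of dimension `1`; in print one of the `m²` lines of the Fermat surface joining the points of
`X⁰ₘ × X⁰ₘ`) whose class `φ_* 1 ∈ H²(X²ₘ(ℂ); ℂ)` has non-zero `(α∗β)`-component.
[cite: Aoki1987, Thm. 1-1 p. 386 and Thm. 1-4 (i) p. 388] [cite: Shioda1979HodgeFermat, Thm. I] -/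
def Shioda1979_lines_represent : Prop :=
  ∀ (m : ℕ) [NeZero m] (α β : Fin (2 * 0 + 2) → ZMod m),
    FermatCharacter.IsHodge α → FermatCharacter.IsHodge β →
    ∃ (μ : OrientationFamily) (e : ℕ) (E : Motives.SchemeOver ℂ) (hE : IsSmoothProjective e E)
      (hX : IsSmoothProjective (2 * (0 + 0 + 1)) (fermatHypersurface (2 * (0 + 0 + 1)) m))
      (φ : E ⟶ fermatHypersurface (2 * (0 + 0 + 1)) m) (he : e = 1),
      fermatProjector m (FermatCharacter.append α β) (2 * (0 + 0 + 1))
        (complexGysin μ hE hX φ (show 0 + 2 * (2 * (0 + 0 + 1)) = 2 * 1 + 2 * e by omega)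
          (singularCohomology.one ℂ (Motives.ComplexPoints E))) ≠ 0

/-- **Aoki 1987, Thm. 1-4 (i) (`Aoki1987_claim_juxtaposition`) from its five geometric inputs** —
the decomposition assembly, i.e. the tree's proved `Aoki1987_claim_juxtaposition_of_spans` (flat
pull-back and proper push-forward of algebraic classes, "represents ⟹ claim" with (I), case
distinction `r, s = 0` or `≥ 1`, and invariance of claim(·) under permutations of the coordinates).
[cite: Aoki1987, Thm. 1-4 (i) p. 388, p. 386, p. 385] [cite: Shioda1979HodgeFermat, Thm. I] [cite: daSilva2021HodgeFermat, Thm. 2.2 (S) and Cor. 2.3 (a)] -/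
theorem Aoki1987_claim_juxtaposition_holds_of :
    Ran1980_fermatEigenspace_rank_le_one → Shioda1979_typeIISpan_represents →
      Shioda1979_coneSpan_represents_left → Shioda1979_coneSpan_represents_right →
        Shioda1979_lines_represent → Aoki1987_claim_juxtaposition :=
  fun hE1 hspan hleft hright hline =>
    Aoki1987_claim_juxtaposition_of_spans hE1 hspan hleft hright hline

end Literature.AlgebraicGeometry.HodgeTheory

end
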